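/-
Copyright (c) 2026. All rights reserved.
Released under Apache 2.0 license as described in the file LICENSE.
Authors: abc-iut cell, campaign-S prover seat abc-iut-S1 (wave 1).
-/
import Mathlib.RingTheory.Valuation.ValuationRing
import Literature.NumberTheory.GaloisRepresentations.PadicAlgClFiniteSubextensionDvr
import Literature.IUT.LogVolume.IntegerRing
import HarnessLib

/-!
# `𝒪_K` is the integral closure of `ℤ_p` in `K`, finite over `ℤ_p`; the different is nonzero

Sequel to `IntegerRing.lean` ([IUTchIV] §1 Prop. 1.1 notation, kurims p. 9: "`R ⊆ ℚ̄_p` the ring of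
integers of `ℚ̄_p` … `R_i := 𝒪_{k_i} = R ∩ k_i`", i.e. `R_i` IS the integral closure of `ℤ_p` in `k_i`;
"`d_i ∈ ℚ_{≥0}`", i.e. the different is a NONZERO ideal).  Norm-side MLF setting; everything proved.

* scoped instances `Algebra ℤ_[p] K` (the composite `ℤ_p ⊆ ℚ_p → K`, priority `50`, scoped to the cell's
  namespace; for `K = ℚ_p` it agrees pointwise with Mathlib's) with its two scalar towers;
* `norm_le_one_iff_isIntegral` — `‖x‖ ≤ 1 ↔ x` integral over `ℤ_p` (the norm of `K` is the spectral norm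
  over `ℚ_p`, Mathlib `NormedAlgebra.norm_eq_spectralNorm`; unit ball of the spectral norm = integral
  elements, the tree's `spectralNorm_le_one_iff_isIntegral`); hence the scoped instance
  `IsIntegralClosure 𝒪_K ℤ_[p] K` and **`Module.Finite ℤ_[p] 𝒪_K`** (Mathlib `IsIntegralClosure.finite`,
  `K/ℚ_p` finite separable);
* `finiteDimensional` — `K` is finite-dimensional over `ℚ_p` (Riesz: `K` is locally compact);
  `moduleFree_integer`, `finrank_integer` — **`𝒪_K` is free of rank `[K : ℚ_p]` over `ℤ_p`**;
* `different_ne_bot` — **`𝔇 ≠ 0`**, and `differentOrd_nonneg` — **`d ≥ 0`**.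

Classical (Serre, *Local Fields*, Ch. II §2, Ch. III §3); nothing disputed.
-/

noncomputable section

open Metric Set IsLocalRing
open scoped NormedField

namespace Literature.IUT.LogVolume

open Literature.NumberTheory.GaloisRepresentations

attribute [local instance] FractionRing.liftAlgebra FractionRing.isScalarTower_liftAlgebra

variable (p : ℕ) [Fact p.Prime]
variable (K : Type*) [NontriviallyNormedField K] [instK : NormedAlgebra ℚ_[p] K] [IsUltrametricDist K]
include instK

/-! ## `K` as a `ℤ_p`-algebra -/

/-- **`K` as a `ℤ_p`-algebra** through `ℤ_p ⊆ ℚ_p → K` (scoped, low priority).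
[claim: Mochizuki2012, status: disputed] -/
scoped instance (priority := 50) algebraPadicIntField : Algebra ℤ_[p] K :=
  ((algebraMap ℚ_[p] K).comp (algebraMap ℤ_[p] ℚ_[p])).toAlgebra

omit [IsUltrametricDist K] in
/-- `algebraMap ℤ_p K x = x` (through `ℚ_p`). [claim: Mochizuki2012, status: disputed] -/
theorem algebraMap_padicInt_apply (x : ℤ_[p]) :
    algebraMap ℤ_[p] K x = algebraMap ℚ_[p] K (x : ℚ_[p]) := rfl

/-- The tower `ℤ_p → ℚ_p → K`. [claim: Mochizuki2012, status: disputed] -/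
scoped instance isScalarTower_padicInt_padic : IsScalarTower ℤ_[p] ℚ_[p] K :=
  IsScalarTower.of_algebraMap_eq fun _ ↦ rfl

/-- The tower `ℤ_p → 𝒪_K → K`. [claim: Mochizuki2012, status: disputed] -/
scoped instance isScalarTower_padicInt_integer_field : IsScalarTower ℤ_[p] (Valued.integer K) K :=
  IsScalarTower.of_algebraMap_eq fun _ ↦ rfl

/-! ## The unit ball is the integral closure of `ℤ_p` -/

/-- A proper `K` is finite-dimensional over `ℚ_p` (Riesz). [claim: Mochizuki2012, status: disputed] -/
theorem finiteDimensional [ProperSpace K] : FiniteDimensional ℚ_[p] K :=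
  FiniteDimensional.of_locallyCompactSpace ℚ_[p]

/-- **`‖x‖ ≤ 1 ↔ x` is integral over `ℤ_p`** ("`R_i = R ∩ k_i`", [IUTchIV] Prop. 1.1 p. 9): the norm
of `K` is the spectral norm over `ℚ_p`, whose unit ball consists of the `ℤ_p`-integral elements.
[claim: Mochizuki2012, status: disputed] -/
theorem norm_le_one_iff_isIntegral [ProperSpace K] (x : K) : ‖x‖ ≤ 1 ↔ IsIntegral ℤ_[p] x := by
  haveI := finiteDimensional p K
  haveI : Algebra.IsAlgebraic ℚ_[p] K := Algebra.IsAlgebraic.of_finite ℚ_[p] K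
  rw [NormedAlgebra.norm_eq_spectralNorm ℚ_[p] x]
  refine spectralNorm_le_one_iff_isIntegral (R := ℤ_[p]) (fun y ↦ ?_) (Algebra.IsIntegral.isIntegral x)
  constructor
  · intro hy
    exact ⟨⟨y, hy⟩, rfl⟩
  · rintro ⟨r, rfl⟩
    exact r.2

/-- **`𝒪_K` is the integral closure of `ℤ_p` in `K`.** [claim: Mochizuki2012, status: disputed] -/
scoped instance isIntegralClosure_integer [ProperSpace K] :
    IsIntegralClosure (Valued.integer K) ℤ_[p] K where
  algebraMap_injective := Subtype.val_injective
  isIntegral_iff {x} := by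
    rw [← norm_le_one_iff_isIntegral p K x]
    constructor
    · intro hx
      exact ⟨⟨x, Valued.integer.mem_iff.mpr hx⟩, rfl⟩
    · rintro ⟨y, rfl⟩
      exact Valued.integer.norm_le_one y

/-- **`𝒪_K` is a finite `ℤ_p`-module** (integral closure of the Noetherian integrally closed `ℤ_p` in the
finite separable extension `K/ℚ_p`). [claim: Mochizuki2012, status: disputed] -/
scoped instance moduleFinite_integer [ProperSpace K] : Module.Finite ℤ_[p] (Valued.integer K) := by
  haveI := finiteDimensional p K
  exact IsIntegralClosure.finite ℤ_[p] ℚ_[p] K (Valued.integer K)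

/-- `𝒪_K` is integral over `ℤ_p`. [claim: Mochizuki2012, status: disputed] -/
theorem isIntegral_integer [ProperSpace K] : Algebra.IsIntegral ℤ_[p] (Valued.integer K) :=
  IsIntegralClosure.isIntegral_algebra ℤ_[p] K

/-- `K` is torsion-free over `ℤ_p` (injective structure map into a field).
[claim: Mochizuki2012, status: disputed] -/
scoped instance isTorsionFree_field : Module.IsTorsionFree ℤ_[p] K :=
  Module.isTorsionFree_iff_algebraMap_injective.mpr
    ((algebraMap ℚ_[p] K).injective.comp Subtype.val_injective)

/-- **`𝒪_K` is a free `ℤ_p`-module** ("`O_v` free over `ℤ_p`", the integral structure of the tensor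
packets of [IUTchIV] Prop. 1.1 / [IUTchIII] Prop. 3.1). [claim: Mochizuki2012, status: disputed] -/
scoped instance moduleFree_integer [ProperSpace K] : Module.Free ℤ_[p] (Valued.integer K) := by
  haveI := finiteDimensional p K
  exact IsIntegralClosure.module_free ℤ_[p] ℚ_[p] K (Valued.integer K)

/-- **`rank_{ℤ_p} 𝒪_K = [K : ℚ_p]`.** [claim: Mochizuki2012, status: disputed] -/
theorem finrank_integer [ProperSpace K] :
    Module.finrank ℤ_[p] (Valued.integer K) = Module.finrank ℚ_[p] K := by
  haveI := finiteDimensional p K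
  exact IsIntegralClosure.rank ℤ_[p] ℚ_[p] K (Valued.integer K)

/-! ## The different is nonzero -/

/-- The fraction-field extension `Frac(ℤ_p) → Frac(𝒪_K)` is separable (it is `ℚ_p → K`, characteristic
`0`). [claim: Mochizuki2012, status: disputed] -/
theorem isSeparable_fractionRing [ProperSpace K] :
    Algebra.IsSeparable (FractionRing ℤ_[p]) (FractionRing (Valued.integer K)) := by
  haveI := finiteDimensional p K
  have H : RingHom.comp (algebraMap (FractionRing ℤ_[p]) (FractionRing (Valued.integer K)))
      ↑(FractionRing.algEquiv ℤ_[p] ℚ_[p]).symm.toRingEquiv =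
        RingHom.comp ↑(FractionRing.algEquiv (Valued.integer K) K).symm.toRingEquiv
          (algebraMap ℚ_[p] K) := by
    apply IsLocalization.ringHom_ext (nonZeroDivisors ℤ_[p])
    ext x
    simp only [RingHom.coe_comp, RingHom.coe_coe, AlgEquiv.coe_ringEquiv, Function.comp_apply,
      AlgEquiv.commutes, ← IsScalarTower.algebraMap_apply]
    rw [IsScalarTower.algebraMap_apply ℤ_[p] (Valued.integer K) K, AlgEquiv.commutes,
      ← IsScalarTower.algebraMap_apply]
  exact Algebra.IsSeparable.of_equiv_equiv _ _ H

/-- **`𝔇 ≠ 0`**: the different of `𝒪_K` over `ℤ_p` is a nonzero ideal ("`d_i ∈ ℚ_{≥0}`").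
[claim: Mochizuki2012, status: disputed] -/
theorem different_ne_bot [ProperSpace K] : different p K ≠ ⊥ := by
  haveI := isSeparable_fractionRing p K
  exact differentIdeal_ne_bot

/-- A generator of `𝔇` is nonzero. [claim: Mochizuki2012, status: disputed] -/
theorem generator_ne_zero [ProperSpace K] {g : Valued.integer K} (hg : different p K = Ideal.span {g}) :
    g ≠ 0 := by
  intro h
  apply different_ne_bot p K
  rw [hg, h, Ideal.span_singleton_eq_bot]

/-- **`d ≥ 0`** (`‖g‖ ≤ 1` for a generator `g ∈ 𝒪_K` of `𝔇`). [claim: Mochizuki2012, status: disputed] -/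
theorem differentOrd_nonneg [ProperSpace K] : 0 ≤ differentOrd p K := by
  obtain ⟨g, hg⟩ := exists_different_eq_span p K
  have hp1 : (1 : ℝ) < p := by exact_mod_cast (Fact.out : p.Prime).one_lt
  have hg0 := generator_ne_zero p K hg
  have hn : ‖(g : K)‖ = (p : ℝ) ^ (-differentOrd p K) := norm_eq_rpow_neg_differentOrd p K hg hg0
  have hle : ‖(g : K)‖ ≤ 1 := Valued.integer.norm_le_one g
  rw [hn] at hle
  by_contra hneg
  rw [not_le] at hneg
  have : (1 : ℝ) < (p : ℝ) ^ (-differentOrd p K) := Real.one_lt_rpow hp1 (by linarith)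
  linarith

end Literature.IUT.LogVolume

end
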